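import Summits.BirchSwinnertonDyer.BirchSwinnertonDyer.Theorems.SylvesterTwoHeegnerIndexTwoInertParity
import HarnessLib

/-!
# Route `SylvesterTwoHeegnerIndex` (rung K7t), item 19580 `TwoAdicPairHSY`:
# the ODD-INDEX LEMMA in kernel (group theory) and the bound `i ≤ ord₂ q`

HONEST FRAMING (cell b2b-bsdres, seat x1b GEN 48 = O12 class lead; `--supports
stmt-BirchSwinnertonDyer-19580`). Sequel of `…CMNormForm.lean` / `…TwoInertParity.lean` (norm form, `2`-inertness), sibling of
`…TwoAdicPairEngine.lean` (the parity engine). Item 19580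
(`= 2n` with `n : ℕ`) is OPEN and STAYS OPEN as an item. Here the cell's ODD-INDEX LEMMA
(MEMO-bsd-cm-two §15.1: for `2` INERT in `K = ℚ(√−3)`, `E_p(K)[2] = 0`, `P` a generator of `E_p(ℚ)`
modulo torsion, the `ℤ[ω]`-index of `P` in `E_p(K)/tors` is ODD) is made KERNEL as ELEMENTARY GROUP
THEORY (an abelian group `A` without `2`-torsion, an involution `σ`, an additive `θ` with
`θ² + θ + 1 = 0`) — no named fact, no curve — together with the explicit quotient it feeds:

* `isOfFinAddOrder_of_zsmul_ne_zero`, `exists_half_of_odd_torsion` — bookkeeping;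
* **`not_exists_eq_two_smul_add_torsion`** — if an involution `σ` of an abelian group `A` without
  `2`-torsion fixes `P`, `P` is non-torsion and every `σ`-fixed element is `≡ mP (mod torsion)`,
  then `P ∉ 2A + A_tors` (Galois-cohomology-free: a `σ`-anti-fixed torsion point is halved inside
  the odd torsion);
* `memTwo_of_modEq`, `memTwo_rot`, **`two_dvd_of_memTwo`** — for additive `θ` with `θ² + θ + 1 = 0`:
  `2A + A_tors` is `θ`-stable, `θ` permutes the three non-zero residues of `(a, b) mod 2`, so `P ∉ 2A + A_tors` forces
  `a•P + b•θP ∈ 2A + A_tors ⇒ 2 ∣ a ∧ 2 ∣ b`;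
* **`exists_odd_zsmul_eq`** — THE ODD-INDEX LEMMA: `n•Y = a•P + b•θP + T` (`n ≠ 0`) can be re-chosen
  with `n` ODD;
* `eq_two_zpow_mul_norm_div_sq_of_height_identity`, `le_padicValRat_two_of_height_identity_of_odd` —
  the explicit quotient `q = 2^i·(a² − ab + b²)/n²` and, with `n` odd, `ord₂ q = i + ord₂(a² − ab + b²) ≥ i`;
The sequels `…TwoAdicPairDescentEngine.lean` / `…TwoAdicPairOfHeightDisplay.lean` run this over `K = ℚ(ζ₃)` (Galois descent of the
`σ`-fixed part, no `2`-torsion) and proves `TwoAdicPairHSY` on `p ≡ 4 (mod 9)` modulo Hu–Shu–Yin's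
display (bsd), leaving EXACTLY MEMO-bsd-cm-two Thm C on `p ≡ 7 (mod 9)`.

WHAT THIS IS NOT: not 19580 for any `p` (this file is pure group theory + the quotient formula; no
named fact is consumed); nothing about `Ш`; nothing booked, no label moves.
References: [HuShuYin2019] pp. 2, 8, 11, 12; [SilvermanAEC2009] VIII.9.3, X.16 (Ex. 10.16).
-/

set_option autoImplicit false
-- the Summit-side namespace `Summit.BirchSwinnertonDyer.BirchSwinnertonDyer.…` (summit = problem) is mandated by D-0017
set_option linter.dupNamespace false

noncomputable section

open scoped Classical

open WeierstrassCurve WeierstrassCurve.Affine WeierstrassCurve.Affine.Point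

namespace Summit.BirchSwinnertonDyer.BirchSwinnertonDyer.Theorems.SylvesterTwoCMNormForm

/-! ## §8 Group theory: `P ∉ 2A + A_tors` from descent, and the odd-index lemma -/

section OddIndex

variable {A : Type*} [AddCommGroup A]

/-- If `n•x` has finite order and `n ≠ 0` then `x` has finite order. [folklore] -/
theorem isOfFinAddOrder_of_zsmul_ne_zero {n : ℤ} (hn : n ≠ 0) {x : A}
    (h : IsOfFinAddOrder (n • x)) : IsOfFinAddOrder x := by
  rcases Int.natAbs_eq n with h' | h'
  · rw [h', natCast_zsmul] at h
    exact h.of_nsmul (Int.natAbs_ne_zero.mpr hn)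
  · rw [h', neg_smul, natCast_zsmul] at h
    have h'' := h.neg
    rw [neg_neg] at h''
    exact h''.of_nsmul (Int.natAbs_ne_zero.mpr hn)

/-- In an abelian group WITHOUT `2`-torsion every torsion element `D` is halved inside the torsion:
`D = 2•D'` with `D' = c•D` (`D` has odd order `k`; `c = (k+1)/2`). [folklore] -/
theorem exists_half_of_odd_torsion (h2 : ∀ x : A, 2 • x = 0 → x = 0) {D : A}
    (hD : IsOfFinAddOrder D) : ∃ c : ℕ, 2 • (c • D) = D := by
  have hkpos : 0 < addOrderOf D := hD.addOrderOf_pos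
  have hkD : addOrderOf D • D = 0 := addOrderOf_nsmul_eq_zero D
  have hodd : ¬ 2 ∣ addOrderOf D := by
    rintro ⟨j, hj⟩
    have hj0 : 0 < j := by omega
    have h2j : 2 • (j • D) = 0 := by rw [← mul_nsmul', ← hj]; exact hkD
    have hjD : j • D = 0 := h2 _ h2j
    have hdvd := addOrderOf_dvd_of_nsmul_eq_zero hjD
    have := Nat.le_of_dvd hj0 hdvd
    omega
  obtain ⟨j, hj⟩ : ∃ j, addOrderOf D = 2 * j + 1 := ⟨addOrderOf D / 2, by omega⟩
  refine ⟨j + 1, ?_⟩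
  rw [← mul_nsmul', show 2 * (j + 1) = addOrderOf D + 1 by omega, add_nsmul, hkD, one_nsmul,
    zero_add]

/-- **`P ∉ 2A + A_tors` from descent.** Let `σ` be an involution of an abelian group `A` without
`2`-torsion, `P` a non-torsion `σ`-fixed element such that every `σ`-fixed element is `mP + torsion`
(`m : ℤ`) — for `A = E_p(K)`, `σ` = complex conjugation: «`P` generates `E_p(ℚ)` modulo torsion» +
Galois descent. Then `P ≠ 2Q + T` (`T` torsion): `D = Q − σQ` is torsion with `σD = −D`; halving it
INSIDE the odd torsion (`D = 2D'`, `σD' = −D'`) makes `Q − D'` `σ`-fixed, hence `≡ mP`, and then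
`(1 − 2m)P` would be torsion. [cite: HuShuYin2019, p. 8] -/
theorem not_exists_eq_two_smul_add_torsion (σ : A →+ A) (hσ : ∀ x, σ (σ x) = x)
    (h2 : ∀ x : A, 2 • x = 0 → x = 0) {P : A} (hP : ¬IsOfFinAddOrder P) (hσP : σ P = P)
    (hdesc : ∀ X : A, σ X = X → ∃ m : ℤ, IsOfFinAddOrder (X - m • P)) :
    ¬ ∃ (Q T : A), IsOfFinAddOrder T ∧ P = 2 • Q + T := by
  rintro ⟨Q, T, hT, hPQ⟩
  -- `D = Q − σQ`: `2D = σT − T` is torsion, `σD = −D`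
  have hQ2 : 2 • Q = P - T := by rw [hPQ]; abel
  have hσQ2 : 2 • σ Q = P - σ T := by
    have h1 : σ P = σ (2 • Q + T) := by rw [hPQ]
    rw [hσP, map_add, map_nsmul] at h1
    rw [h1]; abel
  set D := Q - σ Q with hDdef
  have h2D : 2 • D = σ T - T := by rw [hDdef, smul_sub, hQ2, hσQ2]; abel
  have hDt : IsOfFinAddOrder D := by
    refine IsOfFinAddOrder.of_nsmul (n := 2) ?_ two_ne_zero
    rw [h2D, sub_eq_add_neg]
    exact (σ.isOfFinAddOrder hT).add hT.neg
  have hσD : σ D = -D := by rw [hDdef, map_sub, hσ]; abel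
  -- halve `D` inside the torsion
  obtain ⟨c, hc⟩ := exists_half_of_odd_torsion h2 hDt
  have hσD' : σ (c • D) = -(c • D) := by rw [map_nsmul, hσD, smul_neg]
  -- `Q₀ = Q − D'` is `σ`-fixed
  have hfix : σ (Q - c • D) = Q - c • D := by
    rw [map_sub, hσD', sub_neg_eq_add, eq_sub_iff_add_eq, add_assoc, ← two_nsmul, hc, hDdef]
    abel
  obtain ⟨m, hm⟩ := hdesc _ hfix
  -- `(1 − 2m)•P = 2•(Q₀ − mP) + 2•D' + T` is torsion
  have key : P - 2 • (m • P) = 2 • (Q - c • D - m • P) + 2 • (c • D) + T := by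
    calc P - 2 • (m • P) = (2 • Q + T) - 2 • (m • P) := by rw [← hPQ]
      _ = 2 • (Q - c • D - m • P) + 2 • (c • D) + T := by simp only [smul_sub]; abel
  have hfin : IsOfFinAddOrder ((1 - 2 * m) • P) := by
    have e : (1 - 2 * m) • P = P - 2 • (m • P) := by
      rw [sub_smul, one_smul, ← smul_smul, two_zsmul, two_nsmul]
    rw [e, key]
    refine ((hm.nsmul (n := 2)).add ?_).add hT
    rw [hc]; exact hDt
  exact hP (isOfFinAddOrder_of_zsmul_ne_zero (n := 1 - 2 * m) (by omega) hfin)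

variable (θ : A →+ A) (hθ3 : ∀ X : A, θ (θ X) + θ X + X = 0) (P : A)

/-- `a•P + b•[ω]P ∈ 2A + A_tors` depends only on `(a, b) mod 2`. [folklore] -/
theorem memTwo_of_modEq {a b a' b' : ℤ} (ha : 2 ∣ a' - a) (hb : 2 ∣ b' - b)
    (h : ∃ (Q T : A), IsOfFinAddOrder T ∧ a • P + b • θ P = 2 • Q + T) :
    ∃ (Q T : A), IsOfFinAddOrder T ∧ a' • P + b' • θ P = 2 • Q + T := by
  obtain ⟨Q, T, hT, hQ⟩ := h
  obtain ⟨u, hu⟩ := ha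
  obtain ⟨v, hv⟩ := hb
  refine ⟨Q + u • P + v • θ P, T, hT, ?_⟩
  have ha' : a' = a + 2 * u := by omega
  have hb' : b' = b + 2 * v := by omega
  have e1 : (2 * u) • P = 2 • (u • P) := by rw [← smul_smul, two_zsmul, two_nsmul]
  have e2 : (2 * v) • θ P = 2 • (v • θ P) := by rw [← smul_smul, two_zsmul, two_nsmul]
  rw [ha', hb', add_smul, add_smul, e1, e2, smul_add, smul_add,
    show a • P + 2 • (u • P) + (b • θ P + 2 • (v • θ P)) = (a • P + b • θ P) + 2 • (u • P) + 2 • (v • θ P)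
      by abel, hQ]
  abel

include hθ3 in
/-- `2A + A_tors` is `[ω]`-stable: `[ω](a•P + b•[ω]P) = (−b)•P + (a − b)•[ω]P` by
`[ω]² = −[ω] − 1`. [cite: HuShuYin2019, p. 4] -/
theorem memTwo_rot {a b : ℤ} (h : ∃ (Q T : A), IsOfFinAddOrder T ∧ a • P + b • θ P = 2 • Q + T) :
    ∃ (Q T : A), IsOfFinAddOrder T ∧ (-b) • P + (a - b) • θ P = 2 • Q + T := by
  obtain ⟨Q, T, hT, hQ⟩ := h
  refine ⟨θ Q, θ T, θ.isOfFinAddOrder hT, ?_⟩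
  have hθθ : θ (θ P) = -θ P - P := by
    have := hθ3 P
    rw [add_assoc, add_eq_zero_iff_eq_neg] at this
    rw [this]; abel
  have h1 : θ (a • P + b • θ P) = 2 • θ Q + θ T := by rw [hQ, map_add, map_nsmul]
  rw [map_add, map_zsmul, map_zsmul, hθθ] at h1
  rw [← h1, sub_smul, neg_smul, smul_sub, smul_neg]
  abel

include hθ3 in
/-- **If `P ∉ 2A + A_tors` then `a•P + b•[ω]P ∈ 2A + A_tors` forces `2 ∣ a` and `2 ∣ b`**: `[ω]`
permutes the three non-zero residues `(1,0) → (0,1) → (1,1) → (1,0)` of `(a, b) mod 2`, so any odd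
residue leads back to `P ∈ 2A + A_tors`. [folklore] -/
theorem two_dvd_of_memTwo (hP2 : ¬ ∃ (Q T : A), IsOfFinAddOrder T ∧ P = 2 • Q + T) {a b : ℤ}
    (h : ∃ (Q T : A), IsOfFinAddOrder T ∧ a • P + b • θ P = 2 • Q + T) : 2 ∣ a ∧ 2 ∣ b := by
  -- `(1, 0)` is forbidden
  have h10 : ¬ ∃ (Q T : A), IsOfFinAddOrder T ∧ (1 : ℤ) • P + (0 : ℤ) • θ P = 2 • Q + T := by
    rintro ⟨Q, T, hT, hQ⟩
    exact hP2 ⟨Q, T, hT, by simpa using hQ⟩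
  have odd_even : ∀ {a b : ℤ}, ¬ 2 ∣ a → 2 ∣ b →
      ¬ ∃ (Q T : A), IsOfFinAddOrder T ∧ a • P + b • θ P = 2 • Q + T := by
    intro a b ha hb h
    exact h10 (memTwo_of_modEq θ P (a := a) (b := b) (by omega) (by omega) h)
  have odd_odd : ∀ {a b : ℤ}, ¬ 2 ∣ a → ¬ 2 ∣ b →
      ¬ ∃ (Q T : A), IsOfFinAddOrder T ∧ a • P + b • θ P = 2 • Q + T := by
    intro a b ha hb h
    exact odd_even (a := -b) (b := a - b) (by omega) (by omega) (memTwo_rot θ hθ3 P h)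
  by_contra hab
  rw [not_and_or] at hab
  by_cases ha : 2 ∣ a
  · have hb : ¬ 2 ∣ b := hab.resolve_left (not_not.mpr ha)
    -- `(even, odd) → (odd, odd)`
    exact odd_odd (a := -b) (b := a - b) (by omega) (by omega) (memTwo_rot θ hθ3 P h)
  · by_cases hb : 2 ∣ b
    · exact odd_even ha hb h
    · exact odd_odd ha hb h

include hθ3 in
/-- **THE ODD-INDEX LEMMA (MEMO-bsd-cm-two §15.1, kernel form).** If `P ∉ 2A + A_tors` then any
relation `n•Y = a•P + b•[ω]P + T` (`n ≠ 0`, `T` torsion) can be re-chosen with `n` ODD: while `n`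
is even, `a, b` are even (`two_dvd_of_memTwo`) and the relation halves (no `2`-torsion is needed
here: `2X` torsion ⇒ `X` torsion). [cite: HuShuYin2019, p. 8] -/
theorem exists_odd_zsmul_eq (hP2 : ¬ ∃ (Q T : A), IsOfFinAddOrder T ∧ P = 2 • Q + T) :
    ∀ (k : ℕ) {n a b : ℤ} {Y T : A}, n.natAbs ≤ k → n ≠ 0 → IsOfFinAddOrder T →
      n • Y = a • P + b • θ P + T →
      ∃ (n' a' b' : ℤ) (T' : A), ¬ 2 ∣ n' ∧ IsOfFinAddOrder T' ∧ n' • Y = a' • P + b' • θ P + T' := by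
  intro k
  induction k with
  | zero =>
    intro n a b Y T hk hn
    exact absurd (Int.natAbs_eq_zero.mp (Nat.le_zero.mp hk)) hn
  | succ k ih =>
    intro n a b Y T hk hn hT hY
    by_cases hodd : 2 ∣ n
    · obtain ⟨n', rfl⟩ := hodd
      have hn' : n' ≠ 0 := by rintro rfl; exact hn (by ring)
      -- `a•P + b•θP = 2•(n'•Y) + (−T)` ⇒ `a, b` even
      have hmem : ∃ (Q T : A), IsOfFinAddOrder T ∧ a • P + b • θ P = 2 • Q + T := by
        refine ⟨n' • Y, -T, hT.neg, ?_⟩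
        have e1 : (2 * n') • Y = 2 • (n' • Y) := by rw [← smul_smul, two_zsmul, two_nsmul]
        rw [e1] at hY
        rw [← sub_eq_add_neg]
        exact eq_sub_of_add_eq hY.symm
      obtain ⟨⟨a', rfl⟩, ⟨b', rfl⟩⟩ := two_dvd_of_memTwo θ hθ3 P hP2 hmem
      -- halve the relation
      have hrel : 2 • (n' • Y - a' • P - b' • θ P) = T := by
        have e1 : (2 * n') • Y = 2 • (n' • Y) := by rw [← smul_smul, two_zsmul, two_nsmul]
        have e2 : (2 * a') • P = 2 • (a' • P) := by rw [← smul_smul, two_zsmul, two_nsmul]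
        have e3 : (2 * b') • θ P = 2 • (b' • θ P) := by rw [← smul_smul, two_zsmul, two_nsmul]
        rw [e1, e2, e3] at hY
        rw [smul_sub, smul_sub, hY]
        abel
      have hT' : IsOfFinAddOrder (n' • Y - a' • P - b' • θ P) := by
        refine IsOfFinAddOrder.of_nsmul (n := 2) ?_ two_ne_zero
        rw [hrel]; exact hT
      have hk' : n'.natAbs ≤ k := by
        have : (2 * n').natAbs = 2 * n'.natAbs := by rw [Int.natAbs_mul]; rfl
        rw [this] at hk
        have := Int.natAbs_pos.mpr hn'
        omega
      exact ih hk' hn' hT' (by abel)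
    · exact ⟨n, a, b, T, hodd, hT, hY⟩

end OddIndex

/-! ## §9 The explicit quotient and the lower bound `i ≤ ord₂ q` for an ODD denominator -/

section Bound

variable {K : Type*} [Field K] [NumberField K] {W : WeierstrassCurve K} [W.IsElliptic] {ω : K}
variable (hω : ω ^ 2 + ω + 1 = 0) (h1 : W.a₁ = 0) (h2 : W.a₂ = 0) (h3 : W.a₃ = 0) (h4 : W.a₄ = 0)
variable {θ : W.toAffine.Point → W.toAffine.Point} (hθ0 : θ 0 = 0)
  (hθ : ∀ (x y : K) (h : W.toAffine.Nonsingular x y),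
    θ (.some x y h) = .some (ω * x) y (nonsingular_omega_mul hω h1 h2 h3 h4 h))

include hω h1 h2 h3 h4 hθ0 hθ

/-- **The explicit quotient.** Under `n•Y = a•P + b•[ω]P + T` (`P` non-torsion, `T` torsion, `n ≠ 0`)
and `q·ĥ(P) = 2^i·ĥ(Y)`: `q = 2^i·(a² − ab + b²)/n²` and `(a, b) ≠ (0, 0)`. [cite: HuShuYin2019, p. 12 (bsd)] -/
theorem eq_two_zpow_mul_norm_div_sq_of_height_identity {P Y T : W.toAffine.Point}
    (hP : ¬IsOfFinAddOrder P) (hT : IsOfFinAddOrder T) {n a b : ℤ} (hn : n ≠ 0)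
    (hY : n • Y = a • P + b • θ P + T) {q : ℚ} (hq : q ≠ 0) {i : ℤ}
    (hid : (q : ℝ) * canonicalHeight P = (2 : ℝ) ^ i * canonicalHeight Y) :
    ¬ (a = 0 ∧ b = 0) ∧ q = (2 : ℚ) ^ i * (((a ^ 2 - a * b + b ^ 2 : ℤ) : ℚ) / ((n : ℚ) ^ 2)) := by
  have hP' : canonicalHeight P ≠ 0 := fun h' => hP ((canonicalHeight_eq_zero_iff_holds P).mp h')
  have hnY : ((n : ℝ) ^ 2) * canonicalHeight Y =
      ((a : ℝ) ^ 2 - a * b + (b : ℝ) ^ 2) * canonicalHeight P := by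
    rw [← canonicalHeight_zsmul_holds, hY, canonicalHeight_add_of_isOfFinAddOrder _ T hT,
      canonicalHeight_zsmul_add_zsmul_omegaRot hω h1 h2 h3 h4 hθ0 hθ]
  have hab : ¬ (a = 0 ∧ b = 0) := by
    rintro ⟨rfl, rfl⟩
    have h0 : ((n : ℝ) ^ 2) * canonicalHeight Y = 0 := by rw [hnY]; simp
    have hY0 : canonicalHeight Y = 0 :=
      (mul_eq_zero.mp h0).resolve_left (pow_ne_zero 2 (by exact_mod_cast hn))
    have : (q : ℝ) * canonicalHeight P = 0 := by rw [hid, hY0, mul_zero]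
    rcases mul_eq_zero.mp this with h' | h'
    · exact hq (by exact_mod_cast h')
    · exact hP' h'
  refine ⟨hab, ?_⟩
  have hqR : (q : ℝ) = (2 : ℝ) ^ i * (((a : ℝ) ^ 2 - a * b + (b : ℝ) ^ 2) / (n : ℝ) ^ 2) := by
    have hn2 : ((n : ℝ) ^ 2) ≠ 0 := pow_ne_zero 2 (by exact_mod_cast hn)
    have hY' : canonicalHeight Y =
        ((a : ℝ) ^ 2 - a * b + (b : ℝ) ^ 2) / (n : ℝ) ^ 2 * canonicalHeight P := by
      rw [div_mul_eq_mul_div, eq_div_iff hn2]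
      linear_combination hnY
    have : (q : ℝ) * canonicalHeight P =
        (2 : ℝ) ^ i * (((a : ℝ) ^ 2 - a * b + (b : ℝ) ^ 2) / (n : ℝ) ^ 2) * canonicalHeight P := by
      rw [hid, hY']
      ring
    exact mul_right_cancel₀ hP' this
  have : ((2 : ℚ) ^ i * ((((a ^ 2 - a * b + b ^ 2 : ℤ) : ℚ)) / ((n : ℚ) ^ 2)) : ℝ) =
      (2 : ℝ) ^ i * (((a : ℝ) ^ 2 - a * b + (b : ℝ) ^ 2) / (n : ℝ) ^ 2) := by push_cast; ring
  exact_mod_cast (hqR.trans this.symm)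

/-- **`i ≤ ord₂ q` when the denominator is ODD**: with `n` odd in `n•Y = a•P + b•[ω]P + T`,
`ord₂ q = i + ord₂(a² − ab + b²) ≥ i`. [cite: HuShuYin2019, p. 12 (bsd)] -/
theorem le_padicValRat_two_of_height_identity_of_odd {P Y T : W.toAffine.Point}
    (hP : ¬IsOfFinAddOrder P) (hT : IsOfFinAddOrder T) {n a b : ℤ} (hn : ¬ 2 ∣ n)
    (hY : n • Y = a • P + b • θ P + T) {q : ℚ} (hq : q ≠ 0) {i : ℤ}
    (hid : (q : ℝ) * canonicalHeight P = (2 : ℝ) ^ i * canonicalHeight Y) :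
    i ≤ padicValRat 2 q := by
  have hn0 : n ≠ 0 := by rintro rfl; exact hn ⟨0, rfl⟩
  obtain ⟨hab, hqe⟩ :=
    eq_two_zpow_mul_norm_div_sq_of_height_identity hω h1 h2 h3 h4 hθ0 hθ hP hT hn0 hY hq hid
  have hNne : ((a ^ 2 - a * b + b ^ 2 : ℤ) : ℚ) ≠ 0 := by
    exact_mod_cast fun h0 => hab (norm_eq_zero_iff.mp h0)
  have hn2 : ((n : ℚ) ^ 2) ≠ 0 := pow_ne_zero 2 (by exact_mod_cast hn0)
  have hne : ((((a ^ 2 - a * b + b ^ 2 : ℤ) : ℚ)) / ((n : ℚ) ^ 2)) ≠ 0 := div_ne_zero hNne hn2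
  have h22 : padicValRat 2 (2 : ℚ) = 1 := by exact_mod_cast padicValRat.self one_lt_two
  have hvn : padicValRat 2 (n : ℚ) = 0 := by
    rw [padicValRat.of_int, padicValInt.eq_zero_of_not_dvd hn]
    rfl
  rw [hqe, padicValRat.mul (zpow_ne_zero i two_ne_zero) hne, padicValRat.zpow, h22, mul_one,
    padicValRat.div hNne hn2, padicValRat.pow, hvn, mul_zero, sub_zero, padicValRat.of_int]
  have : 0 ≤ padicValInt 2 (a ^ 2 - a * b + b ^ 2) := by exact_mod_cast Nat.zero_le _
  omega

end Bound


end Summit.BirchSwinnertonDyer.BirchSwinnertonDyer.Theorems.SylvesterTwoCMNormForm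

end
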